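import Literature.Probability.RandomPlanarGeometry.LoewnerCompactAlive
import Literature.Probability.RandomPlanarGeometry.LoewnerPartialContact
import Literature.Probability.RandomPlanarGeometry.LoewnerRemainingHull
import Literature.Probability.RandomPlanarGeometry.StarHullClopenPiece
import HarnessLib

/-!
# Below the partial contact time: the remaining hull is a finite union of clusters; the partial
# contact time is a stopping time

Topic `Probability/RandomPlanarGeometry`; theorems only (vocabulary of `LoewnerPartialContact`).
For a CONTINUOUS driving function `W` and a `*`-hull `A` with its `ρ`-clusters
(`StarHullClusters`; `0 < ρ`), the set of times of partial contact of a cluster `C` (its compact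
sensor `halfNhd C ρ` met by the closed hull while `C ⊄ K̂_t`) is an interval `[T_N, S)` closed on
the left (`T_N` the hitting time of the sensor, attained for compact sets, `LoewnerCompactAlive`),
so that

* `Loewner.coe_lt_clusterContactTime_iff` — `t < clusterContactTime` iff no partial contact on
  `[0, t]`; `Loewner.exists_isPartialContact_le_iff` — "some partial contact by time `t`" is
  witnessed at `t` or at a rational time (the complement of the whole-swallow condition is open to
  the right);
* `Loewner.remHull_eq_sUnion_of_coe_lt_partialContactTime` — strictly before the partial contact
  time the remaining hull `A ∖ K̂_t` (`Loewner.remHull`) is the union of the clusters missed by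
  `K̂_t`, hence CLOSED (`isClosed_remHull_of_coe_lt_partialContactTime`) and one of FINITELY many
  sets (`finite_image_remHull_Icc_of_coe_le_partialContactTime`);
* `Loewner.measurableSet_partialContactTime_le` — for a family of continuous driving paths from `0`
  with measurable values at times `≤ t`, `{partialContactTime ≤ t}` is measurable (the partial
  contact time is a stopping time of the raw filtration).

This is the hull-side bookkeeping of the through-swallow image chain in the proof of the locality
of SLE₆ (Lawler–Schramm–Werner (2001) Thm. 2.2; Lawler (2005) §6.3 Thm. 6.13).

## References

* G. F. Lawler, *Conformally Invariant Processes in the Plane* (2005), §6.3 Thm. 6.13. [Lawler2005]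
* G. F. Lawler, O. Schramm, W. Werner, Acta Math. 187 (2001), Thm. 2.2. [LawlerSchrammWerner2001]
-/

noncomputable section

open Set Filter Topology Metric Bornology Complex MeasureTheory
open UpperHalfPlane (upperHalfPlaneSet)
open scoped NNReal

namespace Literature.Probability.RandomPlanarGeometry

namespace Loewner

/-! ### The closed hull at time `0` -/

/-- At time `0` the closed hull of a continuous driving function is the single point `W 0`
(every other point flows for a positive time). [folklore] -/
theorem eq_driving_of_mem_closedHull_zero {W : ℝ≥0 → ℝ} (hW : Continuous W) {z : ℂ}
    (hz : z ∈ closedHull W 0) : z = W 0 := by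
  by_contra hne
  have := swallowingTime_pos_holds hW hne
  exact absurd (lt_of_lt_of_le this hz.2) (lt_irrefl _)

/-! ### The interval of partial contacts of one cluster -/

section OneCluster

variable {W : ℝ≥0 → ℝ} {C : Set ℂ} {ρ : ℝ} (hW : Continuous W) (hCb : IsBounded C)
  (hCne : C.Nonempty)
include hW hCb hCne

/-- Partial contact persists backwards down to the hitting time of the sensor: if there is partial
contact at `s`, then also at every `s' ∈ [T_N, s]`. [folklore] -/
theorem IsPartialContact.of_le {s s' : ℝ≥0} (h : IsPartialContact W C ρ s)
    (h1 : hullHitTime W (halfNhd C ρ) ≤ s') (h2 : s' ≤ s) : IsPartialContact W C ρ s' :=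
  ⟨(hullHitTime_le_coe_iff_of_isCompact hW (isCompact_halfNhd hCb hCne ρ)).1 h1,
    fun hsub ↦ h.2 (hsub.trans (closedHull_mono W h2))⟩

/-- A partial contact at `s` forces one at the (finite) hitting time `T_N ≤ s` of the sensor. [folklore] -/
theorem IsPartialContact.exists_hullHitTime_eq {s : ℝ≥0} (h : IsPartialContact W C ρ s) :
    ∃ τ : ℝ≥0, hullHitTime W (halfNhd C ρ) = τ ∧ τ ≤ s ∧ IsPartialContact W C ρ τ := by
  have hle : hullHitTime W (halfNhd C ρ) ≤ s := hullHitTime_le h.1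
  obtain ⟨τ, hτ⟩ := WithTop.ne_top_iff_exists.1 (ne_top_of_le_ne_top WithTop.coe_ne_top hle)
  have hτs : τ ≤ s := by rw [← hτ] at hle; exact WithTop.coe_le_coe.1 hle
  exact ⟨τ, hτ.symm, hτs, h.of_le hW hCb hCne hτ.symm.le hτs⟩

/-- **If the cluster is ever partially contacted, its contact time is the hitting time of its
sensor** (and the infimum is attained there). [folklore] -/
theorem clusterContactTime_eq_hullHitTime {s : ℝ≥0} (h : IsPartialContact W C ρ s) :
    clusterContactTime W C ρ = hullHitTime W (halfNhd C ρ) := by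
  obtain ⟨τ, hτ, -, hτc⟩ := h.exists_hullHitTime_eq hW hCb hCne
  refine le_antisymm (by rw [hτ]; exact clusterContactTime_le hτc) ?_
  exact le_clusterContactTime fun t ht ↦ hullHitTime_le ht.1

/-- **`t < clusterContactTime` iff there is no partial contact on `[0, t]`.** [folklore] -/
theorem coe_lt_clusterContactTime_iff {t : ℝ≥0} :
    (t : WithTop ℝ≥0) < clusterContactTime W C ρ ↔ ∀ s ≤ t, ¬ IsPartialContact W C ρ s := by
  refine ⟨fun h s hs ↦ not_isPartialContact_of_coe_lt h hs, fun h ↦ ?_⟩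
  by_contra hle
  rw [not_lt] at hle
  -- some partial contact exists
  obtain ⟨s, hs⟩ : ∃ s, IsPartialContact W C ρ s := by
    by_contra hnone
    push Not at hnone
    rw [clusterContactTime_eq_top hnone] at hle
    exact absurd hle (not_le.2 (WithTop.coe_lt_top t))
  obtain ⟨τ, hτ, -, hτc⟩ := hs.exists_hullHitTime_eq hW hCb hCne
  rw [clusterContactTime_eq_hullHitTime hW hCb hCne hs, hτ, WithTop.coe_le_coe] at hle
  exact h τ hle hτc

/-- `clusterContactTime ≤ t` iff there is a partial contact by time `t`. [folklore] -/
theorem clusterContactTime_le_coe_iff {t : ℝ≥0} :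
    clusterContactTime W C ρ ≤ t ↔ ∃ s ≤ t, IsPartialContact W C ρ s := by
  rw [← not_lt, coe_lt_clusterContactTime_iff hW hCb hCne]
  push Not
  rfl

omit hW hCb hCne in
/-- **A partial contact by time `t` is witnessed at `t` itself or at a rational time `≤ t`** (for
`C ⊆ ℍ̄`): after a partial contact at `s`, the contact persists, and a point of `C` not swallowed
at `s` stays unswallowed for a while. [folklore] -/
theorem exists_isPartialContact_le_iff (hCH : ∀ z ∈ C, 0 ≤ z.im) {t : ℝ≥0} :
    (∃ s ≤ t, IsPartialContact W C ρ s) ↔ IsPartialContact W C ρ t ∨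
      ∃ q : ℚ, 0 ≤ (q : ℝ) ∧ (q : ℝ) ≤ t ∧ IsPartialContact W C ρ (q : ℝ).toNNReal := by
  constructor
  · rintro ⟨s, hst, hs⟩
    by_cases ht : IsPartialContact W C ρ t
    · exact Or.inl ht
    · right
      have hcont : ¬ Disjoint (closedHull W t) (halfNhd C ρ) := fun hd ↦
        hs.1 (hd.mono_left (closedHull_mono W hst))
      have hsub : C ⊆ closedHull W t := by
        by_contra hns
        exact ht ⟨hcont, hns⟩
      -- a point of `C` not swallowed at `s`, swallowed by `t`
      obtain ⟨c, hcC, hcs⟩ := not_subset.1 hs.2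
      have hsc : (s : WithTop ℝ≥0) < swallowingTime W c := by
        by_contra hle'
        exact hcs ⟨hCH c hcC, not_lt.1 hle'⟩
      have hct : swallowingTime W c ≤ t := (hsub hcC).2
      obtain ⟨u, hu⟩ := WithTop.ne_top_iff_exists.1 (ne_top_of_le_ne_top WithTop.coe_ne_top hct)
      have hsu : (s : ℝ) < u := by
        have : s < u := by rw [← hu] at hsc; exact WithTop.coe_lt_coe.1 hsc
        exact_mod_cast this
      have hut : u ≤ t := by rw [← hu] at hct; exact WithTop.coe_le_coe.1 hct
      obtain ⟨q, hsq, hqu⟩ := exists_rat_btwn hsu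
      have hq0 : 0 ≤ (q : ℝ) := s.coe_nonneg.trans hsq.le
      have hq' : ((q : ℝ).toNNReal : ℝ) = q := Real.coe_toNNReal _ hq0
      refine ⟨q, hq0, hqu.le.trans (by exact_mod_cast hut), ?_, fun hsub' ↦ ?_⟩
      · refine fun hd ↦ hs.1 (hd.mono_left (closedHull_mono W ?_))
        rw [← NNReal.coe_le_coe, hq']; exact hsq.le
      · have h1 : swallowingTime W c ≤ ((q : ℝ).toNNReal : ℝ≥0) := (hsub' hcC).2
        rw [← hu, WithTop.coe_le_coe, ← NNReal.coe_le_coe, hq'] at h1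
        exact absurd h1 (not_le.2 hqu)
  · rintro (h | ⟨q, hq0, hqt, hq⟩)
    · exact ⟨t, le_rfl, h⟩
    · refine ⟨(q : ℝ).toNNReal, ?_, hq⟩
      rw [← NNReal.coe_le_coe, Real.coe_toNNReal _ hq0]; exact hqt

end OneCluster

/-! ### The clusters of a `*`-hull -/

section Clusters

variable {A : Set ℂ} {ρ : ℝ} (hA : IsStarHull A) (hρ : 0 < ρ)
include hA hρ

/-- A `ρ`-cluster of a `*`-hull is a `*`-hull (a clopen piece, `IsStarHull.isStarHull_piece`).
[folklore] -/
theorem isStarHull_of_mem_clusterFamily {C : Set ℂ} (hC : C ∈ clusterFamily A ρ) : IsStarHull C := by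
  obtain ⟨a, ha, rfl⟩ := hC
  have hAc := hA.isBoundedHull.isClosed
  exact hA.isStarHull_piece (deltaCluster_subset ha) (isClosed_deltaCluster hAc hρ ha)
    (isClosed_diff_deltaCluster hAc hρ ha)

/-- Basic facts on a cluster of a `*`-hull: bounded, nonempty, closed, in the closed half-plane,
and at distance `≥ infDist 0 A` from `0`. [folklore] -/
theorem clusterFamily_facts {C : Set ℂ} (hC : C ∈ clusterFamily A ρ) :
    IsBounded C ∧ C.Nonempty ∧ IsClosed C ∧ (∀ z ∈ C, 0 ≤ z.im) ∧ infDist 0 A ≤ infDist 0 C := by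
  obtain ⟨hCA, hCne⟩ := subset_and_nonempty_of_mem_clusterFamily hC
  have hstar := isStarHull_of_mem_clusterFamily hA hρ hC
  exact ⟨hstar.isBoundedHull.1, hCne, hstar.isBoundedHull.isClosed,
    fun z hz ↦ hA.isBoundedHull.im_nonneg (hCA hz), infDist_le_infDist_of_subset hCA hCne⟩

end Clusters

/-! ### The remaining hull strictly before the partial contact time -/

section RemHull

variable {W : ℝ≥0 → ℝ} {A : Set ℂ} {ρ : ℝ} (hA : IsStarHull A) (hρ : 0 < ρ)
include hA hρ

/-- **Strictly before the partial contact time every cluster is untouched or swallowed whole**: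
either the closed hull misses its sensor, or the cluster lies in the closed hull. [folklore] -/
theorem disjoint_or_subset_of_coe_lt_partialContactTime {t : ℝ≥0}
    (ht : (t : WithTop ℝ≥0) < partialContactTime W A ρ) {C : Set ℂ} (hC : C ∈ clusterFamily A ρ) :
    Disjoint (closedHull W t) (halfNhd C ρ) ∨ C ⊆ closedHull W t :=
  disjoint_or_subset_of_not_isPartialContact (not_isPartialContact_of_coe_lt
    ((coe_lt_partialContactTime_iff hA.isBoundedHull.isCompact hρ).1 ht C hC) le_rfl)

/-- **Strictly before the partial contact time, the remaining hull `A ∖ K̂_t` is the union of the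
clusters missed by `K̂_t`.** [cite: Lawler2005, §6.3 Thm. 6.13] -/
theorem remHull_eq_sUnion_of_coe_lt_partialContactTime {t : ℝ≥0}
    (ht : (t : WithTop ℝ≥0) < partialContactTime W A ρ) :
    remHull W A t = ⋃₀ {C ∈ clusterFamily A ρ | Disjoint (closedHull W t) C} := by
  have him : ∀ z ∈ A, 0 ≤ z.im := fun z hz ↦ hA.isBoundedHull.im_nonneg hz
  refine Subset.antisymm (fun a ha ↦ ?_) (sUnion_subset ?_)
  · have haA : a ∈ A := ha.1
    have hC : deltaCluster A ρ a ∈ clusterFamily A ρ := deltaCluster_mem_clusterFamily haA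
    refine ⟨deltaCluster A ρ a, ⟨hC, ?_⟩, mem_deltaCluster_self A ρ a⟩
    rcases disjoint_or_subset_of_coe_lt_partialContactTime hA hρ ht hC with h | h
    · exact h.mono_right (subset_halfNhd (fun z hz ↦ him z (deltaCluster_subset haA hz)) hρ.le)
    · exact absurd (h (mem_deltaCluster_self A ρ a)) ha.2
  · rintro C ⟨hC, hdisj⟩ c hc
    exact ⟨(subset_and_nonempty_of_mem_clusterFamily hC).1 hc, fun hcK ↦ Set.disjoint_left.1 hdisj hcK hc⟩

/-- **Strictly before the partial contact time the remaining hull is closed** (a finite union of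
closed clusters). [cite: Lawler2005, §6.3 Thm. 6.13] -/
theorem isClosed_remHull_of_coe_lt_partialContactTime {t : ℝ≥0}
    (ht : (t : WithTop ℝ≥0) < partialContactTime W A ρ) : IsClosed (remHull W A t) := by
  rw [remHull_eq_sUnion_of_coe_lt_partialContactTime hA hρ ht, sUnion_eq_biUnion]
  refine Set.Finite.isClosed_biUnion ?_ ?_
  · exact (finite_clusterFamily hA.isBoundedHull.isCompact hρ).subset fun _ hC ↦ hC.1
  · rintro C ⟨hC, -⟩
    exact (clusterFamily_facts hA hρ hC).2.2.1

/-- Strictly before the partial contact time the remaining hull is a union of a subfamily of the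
(finite) family of clusters. [folklore] -/
theorem remHull_mem_image_of_coe_lt_partialContactTime {t : ℝ≥0}
    (ht : (t : WithTop ℝ≥0) < partialContactTime W A ρ) :
    remHull W A t ∈ (fun 𝒟 : Set (Set ℂ) ↦ ⋃₀ 𝒟) '' {𝒟 | 𝒟 ⊆ clusterFamily A ρ} :=
  ⟨{C ∈ clusterFamily A ρ | Disjoint (closedHull W t) C}, fun _ hC ↦ hC.1,
    (remHull_eq_sUnion_of_coe_lt_partialContactTime hA hρ ht).symm⟩

/-- **Up to a time `T₀ ≤ partialContactTime`, the remaining hull takes finitely many values**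
(unions of subfamilies of the finite family of clusters, and the value at `T₀`).
[cite: Lawler2005, §6.3 Thm. 6.13] -/
theorem finite_image_remHull_Icc_of_coe_le_partialContactTime {T₀ : ℝ≥0}
    (hT : (T₀ : WithTop ℝ≥0) ≤ partialContactTime W A ρ) : (remHull W A '' Icc 0 T₀).Finite := by
  have hfin : ((fun 𝒟 : Set (Set ℂ) ↦ ⋃₀ 𝒟) '' {𝒟 | 𝒟 ⊆ clusterFamily A ρ}).Finite :=
    (finite_clusterFamily hA.isBoundedHull.isCompact hρ).finite_subsets.image _
  refine (hfin.union (finite_singleton (remHull W A T₀))).subset ?_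
  rintro _ ⟨t, ht, rfl⟩
  rcases ht.2.lt_or_eq with hlt | rfl
  · exact Or.inl (remHull_mem_image_of_coe_lt_partialContactTime hA hρ
      (lt_of_lt_of_le (WithTop.coe_lt_coe.2 hlt) hT))
  · exact Or.inr rfl

/-- **The partial contact time is positive** (`W 0 = 0`, `ρ < infDist 0 A`): at time `0` the
closed hull is `{0}`, off every sensor. [folklore] -/
theorem partialContactTime_pos (hW : Continuous W) (hW0 : W 0 = 0) (hρ0 : ρ < infDist 0 A) :
    0 < partialContactTime W A ρ := by
  have h0 : ((0 : ℝ≥0) : WithTop ℝ≥0) = 0 := rfl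
  rw [← h0, coe_lt_partialContactTime_iff hA.isBoundedHull.isCompact hρ]
  intro C hC
  obtain ⟨hCb, hCne, -, -, hdist⟩ := clusterFamily_facts hA hρ hC
  rw [coe_lt_clusterContactTime_iff hW hCb hCne]
  intro s hs hps
  have hs0 : s = 0 := le_antisymm hs bot_le
  subst hs0
  refine hps.1 (Set.disjoint_left.2 fun z hz hzN ↦ ?_)
  have hz0 : z = 0 := by rw [eq_driving_of_mem_closedHull_zero hW hz, hW0, Complex.ofReal_zero]
  rw [hz0] at hzN
  exact zero_notMem_halfNhd (hρ0.trans_le hdist) hzN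

end RemHull

/-! ### The partial contact time is a stopping time -/

section Measurable

variable {Ω : Type*} {mΩ : MeasurableSpace Ω} {W : Ω → ℝ≥0 → ℝ} {A C : Set ℂ} {ρ : ℝ} {t : ℝ≥0}
  (hc : ∀ ω, Continuous (W ω)) (hW0 : ∀ ω, W ω 0 = 0)
  (hmeas : ∀ s, s ≤ t → Measurable fun ω ↦ W ω s) (hρ : 0 < ρ)
include hc hW0 hmeas hρ

/-- The event of a partial contact of the `*`-hull `C` (with `ρ < infDist 0 C`) at a time `s ≤ t`
is measurable: contact with the compact sensor (`LoewnerCompactAlive`) and the complement of the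
whole-swallow event. [folklore] -/
theorem measurableSet_isPartialContact (hC : IsStarHull C) (hCne : C.Nonempty)
    (hρ0 : ρ < infDist 0 C) {s : ℝ≥0} (hs : s ≤ t) :
    MeasurableSet {ω | IsPartialContact (W ω) C ρ s} := by
  have hmeas' : ∀ r, r ≤ s → Measurable fun ω ↦ W ω r := fun r hr ↦ hmeas r (hr.trans hs)
  have him : ∀ z ∈ C, 0 ≤ z.im := fun z hz ↦ hC.isBoundedHull.im_nonneg hz
  have h1 : MeasurableSet {ω | ¬ Disjoint (closedHull (W ω) s) (halfNhd C ρ)} :=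
    measurableSet_not_disjoint_closedHull_of_isCompact hc hW0 hmeas'
      (isCompact_halfNhd hC.isBoundedHull.1 hCne ρ) (halfNhd_subset_closure C ρ)
      (zero_notMem_halfNhd hρ0) (halfNhd_subset_closure_inter him hCne hρ)
  obtain ⟨e, he, hdense⟩ := exists_denseSeq hC hCne
  have h2 : MeasurableSet {ω | C ⊆ closedHull (W ω) s} := measurableSet_subset_closedHull hc hmeas' he hdense
  exact h1.inter h2.compl

/-- **`{clusterContactTime ≤ t}` is measurable** for a `*`-hull cluster `C` with `ρ < infDist 0 C`.
[folklore] -/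
theorem measurableSet_clusterContactTime_le (hC : IsStarHull C) (hCne : C.Nonempty)
    (hρ0 : ρ < infDist 0 C) : MeasurableSet {ω | clusterContactTime (W ω) C ρ ≤ t} := by
  have him : ∀ z ∈ C, 0 ≤ z.im := fun z hz ↦ hC.isBoundedHull.im_nonneg hz
  have heq : {ω | clusterContactTime (W ω) C ρ ≤ t} = {ω | IsPartialContact (W ω) C ρ t} ∪
      ⋃ q : ℚ, {ω | 0 ≤ (q : ℝ) ∧ (q : ℝ) ≤ t ∧ IsPartialContact (W ω) C ρ (q : ℝ).toNNReal} := by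
    ext ω
    simp only [mem_setOf_eq, mem_union, mem_iUnion]
    rw [clusterContactTime_le_coe_iff (hc ω) hC.isBoundedHull.1 hCne,
      exists_isPartialContact_le_iff him]
  rw [heq]
  refine (measurableSet_isPartialContact hc hW0 hmeas hρ hC hCne hρ0 le_rfl).union
    (MeasurableSet.iUnion fun q ↦ ?_)
  by_cases hq : 0 ≤ (q : ℝ) ∧ (q : ℝ) ≤ t
  · have hqt : (q : ℝ).toNNReal ≤ t := by
      rw [← NNReal.coe_le_coe, Real.coe_toNNReal _ hq.1]; exact hq.2
    have : {ω | 0 ≤ (q : ℝ) ∧ (q : ℝ) ≤ t ∧ IsPartialContact (W ω) C ρ (q : ℝ).toNNReal} =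
        {ω | IsPartialContact (W ω) C ρ (q : ℝ).toNNReal} := by
      ext ω; simp only [mem_setOf_eq]; tauto
    rw [this]
    exact measurableSet_isPartialContact hc hW0 hmeas hρ hC hCne hρ0 hqt
  · have : {ω | 0 ≤ (q : ℝ) ∧ (q : ℝ) ≤ t ∧ IsPartialContact (W ω) C ρ (q : ℝ).toNNReal} = ∅ := by
      ext ω; simp only [mem_setOf_eq, mem_empty_iff_false, iff_false]; tauto
    rw [this]
    exact MeasurableSet.empty

/-- **`{partialContactTime ≤ t}` is measurable** for a `*`-hull `A` with `ρ < infDist 0 A`: a finite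
union over the clusters. Hence the partial contact time of a family of continuous driving paths
adapted to a filtration is a stopping time of that (raw) filtration. [cite: Lawler2005, §6.3 Thm. 6.13] -/
theorem measurableSet_partialContactTime_le (hA : IsStarHull A) (hρ0 : ρ < infDist 0 A) :
    MeasurableSet {ω | partialContactTime (W ω) A ρ ≤ t} := by
  have hAK := hA.isBoundedHull.isCompact
  have heq : {ω | partialContactTime (W ω) A ρ ≤ t} =
      ⋃ C ∈ clusterFamily A ρ, {ω | clusterContactTime (W ω) C ρ ≤ t} := by
    ext ω
    simp only [mem_setOf_eq, mem_iUnion, exists_prop]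
    constructor
    · intro h
      by_contra hcon
      push Not at hcon
      exact absurd h (not_le.2 ((coe_lt_partialContactTime_iff hAK hρ).2 fun C hC ↦ hcon C hC))
    · rintro ⟨C, hC, hle⟩
      exact (partialContactTime_le hC).trans hle
  rw [heq]
  refine (finite_clusterFamily hAK hρ).measurableSet_biUnion fun C hC ↦ ?_
  obtain ⟨-, hCne, -, -, hdist⟩ := clusterFamily_facts hA hρ hC
  exact measurableSet_clusterContactTime_le hc hW0 hmeas hρ (isStarHull_of_mem_clusterFamily hA hρ hC)
    hCne (hρ0.trans_le hdist)

end Measurable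

end Loewner

end Literature.Probability.RandomPlanarGeometry

end
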